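import Summits.QuantumAdvantage.QuantumAdvantage.Theorems.NearExactIsExact.Negative.LevelSixMinimalCore

/-!
# No MINIMAL level-6 side at `Φ ≥ 61/64` on 14 bits (NearExactIsExact, disprover gen 24 — boundary version of `LevelSixSixtyOneFourteen`)

Negative/structural theorem for the crux `CubicForrelation.NearExactIsExact` (item r2), finite slice `n = 14`.
HONEST FRAMING: a statement about cubic Boolean functions on 14 bits — NOT summit progress; no violation of `NearExactIsExact`.

`…Negative.ThetaFourteenSixtyOne` shows `Φ > 61/64 ⇒ Φ = 1` at `n = 14`; whether `61/64` is ATTAINED is open.  At `Φ = 61/64` the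
level-6 budget is `B = Σ(u' − 2s)² = 6144 = 1.5·2¹²`, so the odd set `P = {u' odd}` of a level-6 side has `#P ∈ {2¹², 6144}` and the
Kasami–Tokura step of `levelSix_pair_false_61` no longer pins `#P = 2¹²`.  This file shows that the MINIMAL case `#P = 2¹²` is nevertheless
dead at `Φ ≥ 61/64` against EVERY cubic partner (engine: `…Negative.LevelSixMinimalCore.lsm_core`):
* `lsm_levelSix_partner_false`: a level-6 proper partner needs `|e_f| ≥ 24` at the four frequencies, budget `≥ 2¹² + 4·575 > 6144`;
* `lsm_typeO_partner_false`: a type-O partner (`W_f = 32v`, `v` odd) needs `|v − 4(−1)^g| ≥ 48` there, budget `≥ 16380 + 4·2304 > 24576`;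
* `levelSix_minimal_false_61c`: with Ax and `fo_levelSeven` for the partner — NO cubic pair on 14 bits with `Φ ≥ 61/64` has a level-6
  side whose odd set has `2¹²` points; `levelSix_odd_card_gt_61c`: so a level-6 side at `Φ ≥ 61/64` has `> 2¹²` odd points (at
  `Φ = 61/64` this means all of the budget sits on `P`, `#P = 6144`, `|W_g| ∈ {64,128,192}` — the configuration left open).

References: T. Kasami, N. Tokura, IEEE Trans. Inform. Theory 16 (1970); R. O'Donnell (2014) §3.3.  Standard axioms only.
-/

set_option linter.dupNamespace false -- D-0017: single-problem summit ⇒ `QuantumAdvantage.QuantumAdvantage` by design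

noncomputable section

namespace Summit.QuantumAdvantage.QuantumAdvantage.Theorems.NearExactIsExact.Negative.LevelSixMinimalSixtyOne

open Finset
open Literature.Computability.QuantumComplexity
open Literature.Computability.QuantumComplexity.BuzetChailloux (bxor zeroVec bxor_bxor_cancel_left bxor_zeroVec zeroVec_bxor bxor_comm
  bxor_self signOf_sq)
open Literature.Computability.QuantumComplexity.DerivativeWalsh (W sum_W_sq twist_bxor_left sum_char_subspace)
open Summit.QuantumAdvantage.QuantumAdvantage.Theorems.CubicForrelation.NearExactIsExact
open Summit.QuantumAdvantage.QuantumAdvantage.Theorems.SignedCubicForrelationNotPrBPP.Negative.HalfQuad (forrelation_comm)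
open Summit.QuantumAdvantage.QuantumAdvantage.Theorems.NearExactIsExact.Negative.LevelSixSixtyOnePrep
open Summit.QuantumAdvantage.QuantumAdvantage.Theorems.NearExactIsExact.Negative.LevelSixMinimalCore

/-! ### The two kinds of cubic partner -/

/-- **Level-6 proper partner.**  If moreover `f` is cubic with `W_f = 64v'`, some `v'(y)` odd, and `61/64 ≤ Φ(f,g)`: contradiction
(`|e_f| ≥ 24` at the four frequencies, so `Σ e_f² ≥ 2¹² + 4·575 > 6144 ≥ B`).  NOT summit progress. [this work] -/
theorem lsm_levelSix_partner_false (f g : (Fin (7 + 7) → Bool) → Bool) (hf : IsDegLeFun 3 f) (hg : IsDegLeFun 3 g)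
    (u' : (Fin (7 + 7) → Bool) → ℤ) (hu' : ∀ x, W (fun y => signOf (g y)) x = (2 : ℝ) ^ 6 * (u' x : ℝ))
    (hoddg : ∃ x, Odd (u' x))
    (hPcard : #(univ.filter fun x : Fin (7 + 7) → Bool => decide (Odd (u' x)) = true) = 4096)
    (v' : (Fin (7 + 7) → Bool) → ℤ) (hv' : ∀ y, W (fun x => signOf (f x)) y = (2 : ℝ) ^ 6 * (v' y : ℝ))
    (hoddf : ∃ y, Odd (v' y)) (hΦ : (61 / 64 : ℝ) ≤ forrelation f g) : False := by
  classical
  obtain ⟨x₁, hx₁⟩ := hoddg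
  obtain ⟨y₁, hy₁⟩ := hoddf
  -- the two budgets coincide and are `≤ 6144`
  set B : ℤ := ∑ x, (u' x - 2 * sZ (f x)) ^ 2 with hBdef
  have hBR : ((B : ℤ) : ℝ) = (2 : ℝ) ^ 17 * (1 - forrelation f g) := by rw [hBdef]; exact fl_budget6 f g u' hu'
  have hBle : B ≤ 6144 := by
    have h : ((B : ℤ) : ℝ) ≤ 6144 := by rw [hBR]; nlinarith
    exact_mod_cast h
  have hBf : (∑ y, (v' y - 2 * sZ (g y)) ^ 2 : ℤ) = B := by
    have h : ((∑ y, (v' y - 2 * sZ (g y)) ^ 2 : ℤ) : ℝ) = ((B : ℤ) : ℝ) := by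
      rw [fl_budget6 g f v' hv', hBR, forrelation_comm]
    exact_mod_cast h
  obtain ⟨F, hF4, hbig⟩ := lsm_core f g hg u' hu' x₁ hx₁ hPcard hBle
  -- the partner: parity quadratic, `≥ 2¹²` odd points, base cost `1` on each
  have hq : IsDegLeFun 2 (fun y => decide (Odd (v' y))) :=
    stub_walshTower stub_axParity (7 + 7) 6 2 f v' hf hv' (by intro k hk hkn; omega)
  have hfiltf : (univ.filter fun y : Fin (7 + 7) → Bool => decide (Odd (v' y)) = true) = univ.filter fun y => Odd (v' y) :=
    filter_congr fun y _ => by rw [decide_eq_true_iff]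
  have hPfge : 4096 ≤ #(univ.filter fun y : Fin (7 + 7) → Bool => Odd (v' y)) := by
    have h := bb_rmWeight_holds (7 + 7) 2 (fun y => decide (Odd (v' y))) hq ⟨y₁, decide_eq_true hy₁⟩
    rw [hfiltf] at h; norm_num at h; omega
  have hsumPf : (∑ y, (if Odd (v' y) then 1 else 0 : ℤ)) = #(univ.filter fun y : Fin (7 + 7) → Bool => Odd (v' y)) := by
    rw [sum_boole]
  have hbasef : ∀ y, (if Odd (v' y) then 1 else 0 : ℤ) ≤ (v' y - 2 * sZ (g y)) ^ 2 := by
    intro y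
    by_cases h : Odd (v' y)
    · rw [if_pos h]; exact tp_res_sq_ge_one (tp_sZ_cases (g y)) h
    · rw [if_neg h]; exact sq_nonneg _
  -- `256(−1)^g − 2W_f = −128 e_f`, so `|e_f| ≥ 24` on `F`
  have hFour : ∀ y, (256 : ℝ) * signOf (g y) - 2 * W (fun x => signOf (f x)) y = -128 * (((v' y - 2 * sZ (g y) : ℤ)) : ℝ) := by
    intro y
    rw [hv' y]
    push_cast
    rw [tp_sZ_cast]
    ring
  have hbig' : ∀ y ∈ F, (576 : ℤ) ≤ (v' y - 2 * sZ (g y)) ^ 2 := by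
    intro y hy
    have h2 := hbig y hy
    rw [hFour y, abs_mul, abs_neg, abs_of_pos (by norm_num : (0 : ℝ) < 128)] at h2
    have h3 : (24 : ℝ) ≤ |(((v' y - 2 * sZ (g y) : ℤ)) : ℝ)| := by linarith
    have h4 : (24 : ℤ) ≤ |v' y - 2 * sZ (g y)| := by
      rw [← Int.cast_abs] at h3
      exact_mod_cast h3
    nlinarith [sq_abs (v' y - 2 * sZ (g y)), abs_nonneg (v' y - 2 * sZ (g y))]
  have hlow : ∀ y, (if Odd (v' y) then 1 else 0 : ℤ) + (if y ∈ F then 575 else 0 : ℤ) ≤ (v' y - 2 * sZ (g y)) ^ 2 := by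
    intro y
    by_cases hy : y ∈ F
    · rw [if_pos hy]
      have h := hbig' y hy
      by_cases ho : Odd (v' y)
      · rw [if_pos ho]; linarith
      · rw [if_neg ho]; linarith
    · rw [if_neg hy, add_zero]; exact hbasef y
  have hsumF : (∑ y, (if y ∈ F then 575 else 0 : ℤ)) = 2300 := by
    rw [sum_ite_mem, univ_inter, sum_const, nsmul_eq_mul, hF4]
    norm_num
  have htot := sum_le_sum fun y (_ : y ∈ (univ : Finset (Fin (7 + 7) → Bool))) => hlow y
  rw [sum_add_distrib, hsumPf, hsumF, hBf] at htot
  have : (4096 : ℤ) ≤ #(univ.filter fun y : Fin (7 + 7) → Bool => Odd (v' y)) := by exact_mod_cast hPfge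
  linarith

/-- **Type-O partner.**  If moreover `f` is type O (`W_f = 32v`, all `v(y)` odd) and `61/64 ≤ Φ(f,g)`: contradiction
(`256(−1)^g − 2W_f = −64(v − 4(−1)^g)`, so `|v − 4(−1)^g| ≥ 48` at four points and the type-O budget is `≥ 16380 + 4·2304 > 24576`).
NOT summit progress. [this work] -/
theorem lsm_typeO_partner_false (f g : (Fin (7 + 7) → Bool) → Bool) (hg : IsDegLeFun 3 g)
    (u' : (Fin (7 + 7) → Bool) → ℤ) (hu' : ∀ x, W (fun y => signOf (g y)) x = (2 : ℝ) ^ 6 * (u' x : ℝ))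
    (hoddg : ∃ x, Odd (u' x))
    (hPcard : #(univ.filter fun x : Fin (7 + 7) → Bool => decide (Odd (u' x)) = true) = 4096)
    (v : (Fin (7 + 7) → Bool) → ℤ) (hv : ∀ y, W (fun x => signOf (f x)) y = (2 : ℝ) ^ 5 * (v y : ℝ))
    (hvodd : ∀ y, Odd (v y)) (hΦ : (61 / 64 : ℝ) ≤ forrelation f g) : False := by
  classical
  obtain ⟨x₁, hx₁⟩ := hoddg
  set B : ℤ := ∑ x, (u' x - 2 * sZ (f x)) ^ 2 with hBdef
  have hBR : ((B : ℤ) : ℝ) = (2 : ℝ) ^ 17 * (1 - forrelation f g) := by rw [hBdef]; exact fl_budget6 f g u' hu'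
  have hBle : B ≤ 6144 := by
    have h : ((B : ℤ) : ℝ) ≤ 6144 := by rw [hBR]; nlinarith
    exact_mod_cast h
  obtain ⟨F, hF4, hbig⟩ := lsm_core f g hg u' hu' x₁ hx₁ hPcard hBle
  -- the type-O budget of the reversed pair
  set B5 : ℤ := ∑ y, (v y - 4 * sZ (g y)) ^ 2 with hB5def
  have hB5R : ((B5 : ℤ) : ℝ) = (2 : ℝ) ^ 19 * (1 - forrelation f g) := by
    rw [hB5def, forrelation_comm]; exact fl_budget5 g f v hv
  have hB5le : B5 ≤ 24576 := by
    have h : ((B5 : ℤ) : ℝ) ≤ 24576 := by rw [hB5R]; nlinarith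
    exact_mod_cast h
  have hbase5 : ∀ y, (1 : ℤ) ≤ (v y - 4 * sZ (g y)) ^ 2 := by
    intro y
    have ho : Odd (v y - 4 * sZ (g y)) := by
      refine Int.odd_sub.2 (iff_of_true (hvodd y) ⟨2 * sZ (g y), by ring⟩)
    have hne : v y - 4 * sZ (g y) ≠ 0 := fun h => by rw [h] at ho; exact (Int.not_odd_iff_even.2 (by decide)) ho
    nlinarith [sq_abs (v y - 4 * sZ (g y)), Int.one_le_abs hne]
  have hFour : ∀ y, (256 : ℝ) * signOf (g y) - 2 * W (fun x => signOf (f x)) y = -64 * (((v y - 4 * sZ (g y) : ℤ)) : ℝ) := by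
    intro y
    rw [hv y]
    push_cast
    rw [tp_sZ_cast]
    ring
  have hbig' : ∀ y ∈ F, (2304 : ℤ) ≤ (v y - 4 * sZ (g y)) ^ 2 := by
    intro y hy
    have h2 := hbig y hy
    rw [hFour y, abs_mul, abs_neg, abs_of_pos (by norm_num : (0 : ℝ) < 64)] at h2
    have h3 : (48 : ℝ) ≤ |(((v y - 4 * sZ (g y) : ℤ)) : ℝ)| := by linarith
    have h4 : (48 : ℤ) ≤ |v y - 4 * sZ (g y)| := by
      rw [← Int.cast_abs] at h3
      exact_mod_cast h3
    nlinarith [sq_abs (v y - 4 * sZ (g y)), abs_nonneg (v y - 4 * sZ (g y))]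
  have hlow : ∀ y, (1 : ℤ) + (if y ∈ F then 2303 else 0 : ℤ) ≤ (v y - 4 * sZ (g y)) ^ 2 := by
    intro y
    by_cases hy : y ∈ F
    · rw [if_pos hy]; linarith [hbig' y hy]
    · rw [if_neg hy, add_zero]; exact hbase5 y
  have hsumF : (∑ y, (if y ∈ F then 2303 else 0 : ℤ)) = 9212 := by
    rw [sum_ite_mem, univ_inter, sum_const, nsmul_eq_mul, hF4]
    norm_num
  have htot := sum_le_sum fun y (_ : y ∈ (univ : Finset (Fin (7 + 7) → Bool))) => hlow y
  rw [sum_add_distrib, sum_const, card_univ, Fintype.card_fun, Fintype.card_bool, Fintype.card_fin, hsumF] at htot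
  norm_num at htot
  linarith

/-! ### Assembly: no minimal level-6 side at `Φ ≥ 61/64` -/

/-- **THEOREM (no minimal level-6 side at `Φ ≥ 61/64`, n = 14).**  For cubic `f, g : 𝔽₂¹⁴ → 𝔽₂` with `W_g = 64u'`, some `u'(x)` odd and
`#{u' odd} = 2¹²` (the odd set is then a 12-flat), `Φ(f,g) < 61/64`.  Proof: by Ax the partner has `W_f = 32u_f`; all `u_f` odd is
`lsm_typeO_partner_false`; otherwise `W_f = 64v'` and either some `v'` is odd (`lsm_levelSix_partner_false`) or `W_f ∈ 128ℤ` and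
`fo_levelSeven` (for the pair `(g,f)`) gives `Φ = 1` or `15/16` — but `Φ ≤ 1 − 2¹²/2¹⁷ = 31/32` from the budget, and `15/16 < 61/64`.
NOT summit progress. [this work] -/
theorem levelSix_minimal_false_61c (f g : (Fin (7 + 7) → Bool) → Bool) (hf : IsDegLeFun 3 f) (hg : IsDegLeFun 3 g)
    (u' : (Fin (7 + 7) → Bool) → ℤ) (hu' : ∀ x, W (fun y => signOf (g y)) x = (2 : ℝ) ^ 6 * (u' x : ℝ))
    (hoddg : ∃ x, Odd (u' x))
    (hPcard : #(univ.filter fun x : Fin (7 + 7) → Bool => decide (Odd (u' x)) = true) = 4096)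
    (hΦ : (61 / 64 : ℝ) ≤ forrelation f g) : False := by
  classical
  obtain ⟨uf, huf⟩ := tw_base f hf 5 (by norm_num)
  by_cases hof : ∀ y, Odd (uf y)
  · exact lsm_typeO_partner_false f g hg u' hu' hoddg hPcard uf huf hof hΦ
  · push Not at hof
    obtain ⟨y₀, hy₀⟩ := hof
    have hev : ∀ y, ¬ Odd (uf y) := fun y h => hy₀ ((fd_parity_const f uf hf huf y y₀).1 h)
    have hu6 := tw_level_up f uf huf hev
    by_cases h6 : ∃ y, Odd (uf y / 2)
    · exact lsm_levelSix_partner_false f g hf hg u' hu' hoddg hPcard (fun y => uf y / 2) hu6 h6 hΦ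
    · push Not at h6
      have hu7 := tw_level_up f (fun y => uf y / 2) hu6 h6
      have hΦ' : (15 / 16 : ℝ) ≤ forrelation g f := by rw [forrelation_comm]; linarith
      -- the budget caps `Φ ≤ 31/32`, so `Φ = 1` is impossible; the bent value `15/16` is below `61/64`
      obtain ⟨x₁, hx₁⟩ := hoddg
      have hfilt : (univ.filter fun x : Fin (7 + 7) → Bool => decide (Odd (u' x)) = true) =
          univ.filter fun x => Odd (u' x) := filter_congr fun x _ => by rw [decide_eq_true_iff]
      have hsumP : (∑ x, (if Odd (u' x) then 1 else 0 : ℤ)) = #(univ.filter fun x : Fin (7 + 7) → Bool => Odd (u' x)) := by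
        rw [sum_boole]
      have hbase : ∀ x, (if Odd (u' x) then 1 else 0 : ℤ) ≤ (u' x - 2 * sZ (f x)) ^ 2 := by
        intro x
        by_cases h : Odd (u' x)
        · rw [if_pos h]; exact tp_res_sq_ge_one (tp_sZ_cases (f x)) h
        · rw [if_neg h]; exact sq_nonneg _
      have hPle : (4096 : ℤ) ≤ ∑ x, (u' x - 2 * sZ (f x)) ^ 2 := by
        have h := sum_le_sum fun x (_ : x ∈ (univ : Finset (Fin (7 + 7) → Bool))) => hbase x
        rw [hsumP, ← hfilt, hPcard] at h
        exact_mod_cast h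
      have hBR := fl_budget6 f g u' hu'
      have hlt1 : forrelation f g < 1 := by
        have : (4096 : ℝ) ≤ (2 : ℝ) ^ 17 * (1 - forrelation f g) := by rw [← hBR]; exact_mod_cast hPle
        nlinarith
      rcases fo_levelSeven g f hg hf _ hu7 hΦ' with h | h
      · rw [forrelation_comm] at h; linarith
      · rw [forrelation_comm] at h; linarith [h.2]

/-- **Corollary.**  At `Φ ≥ 61/64` a level-6 side (`W_g = 64u'`, some `u'` odd) of a cubic pair on 14 bits has MORE than `2¹²` odd points
(hence, at `Φ = 61/64` exactly, `#{u' odd} = 6144` once the third weight of `RM(2,14)` is invoked — not done here).  NOT summit progress.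
[this work] -/
theorem levelSix_odd_card_gt_61c (f g : (Fin (7 + 7) → Bool) → Bool) (hf : IsDegLeFun 3 f) (hg : IsDegLeFun 3 g)
    (u' : (Fin (7 + 7) → Bool) → ℤ) (hu' : ∀ x, W (fun y => signOf (g y)) x = (2 : ℝ) ^ 6 * (u' x : ℝ))
    (hoddg : ∃ x, Odd (u' x)) (hΦ : (61 / 64 : ℝ) ≤ forrelation f g) :
    4096 < #(univ.filter fun x : Fin (7 + 7) → Bool => Odd (u' x)) := by
  classical
  obtain ⟨x₁, hx₁⟩ := hoddg
  have hp : IsDegLeFun 2 (fun x => decide (Odd (u' x))) :=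
    stub_walshTower stub_axParity (7 + 7) 6 2 g u' hg hu' (by intro k hk hkn; omega)
  have hfilt : (univ.filter fun x : Fin (7 + 7) → Bool => decide (Odd (u' x)) = true) = univ.filter fun x => Odd (u' x) :=
    filter_congr fun x _ => by rw [decide_eq_true_iff]
  have hge : 4096 ≤ #(univ.filter fun x : Fin (7 + 7) → Bool => Odd (u' x)) := by
    have h := bb_rmWeight_holds (7 + 7) 2 (fun x => decide (Odd (u' x))) hp ⟨x₁, decide_eq_true hx₁⟩
    rw [hfilt] at h; norm_num at h; omega
  rcases hge.eq_or_lt with h | h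
  · exact (levelSix_minimal_false_61c f g hf hg u' hu' ⟨x₁, hx₁⟩ (by rw [hfilt]; exact h.symm) hΦ).elim
  · exact h

end Summit.QuantumAdvantage.QuantumAdvantage.Theorems.NearExactIsExact.Negative.LevelSixMinimalSixtyOne

end
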